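import Literature.NumberTheory.EllipticCurves.PointCountEulerCriterion
import HarnessLib

/-!
# BSD rank-≤1 residual cell, class X11b (Jetchev–Cha-certificate pairs of unit `b2b-bsdres-x11c`):
# Frobenius point-count certificates `#Ẽ(𝔽_ℓ) = n` for the Tamagawa-obstructed models (kernel-decided data; part 1 of 2)

HONEST FRAMING (cell `b2b-bsdres-*`, verbatim): prove what is provable now; shrink each hard class
to its core with data; no claim beyond stated classes; COMBINATION classes deleted from PUBLISHED
theorems only, CONSTRUCTION-shaped remainder typed; this is not "finishing BSD". Class X11b stays
CONSTRUCTION-SHAPED; everything here is PER PAIR; no lane verdict is changed; no named fact.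

Theorems only (kernel-decided data: no definition, no named fact, no `native_decide`), in the exact
shape of `X11b/ChaPairsCards.lean` (gen 3; `card_c<label>_<ℓ>`): for each of the 37 Tamagawa-obstructed
RESISTANT pairs of X11 ∧ r = 1 ∧ ¬sst ∧ p ≥ 5 that carry a Jetchev–Cha certificate
(HOME/b2b-bsdres-x11c/REPORT.md §12; all at `p = 5`, `ρ̄_{E,5}` of image `5S4`/`5Ns`, `5 ∣ c_q` at one
bad prime `q`) and ONE odd prime `ℓ` of good reduction (`ℓ ∤ Δ`, `ℓ ≠ 5`, the smallest one for which
`X² − a_ℓX + ℓ` has no root modulo `5`), the point count `#Ẽ(𝔽_ℓ) = n` of the reduction of Cremona's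
model, decided by the kernel through `WeierstrassCurve.natCard_point_eq_one_add_card` and
`card_sol_eq_sum_euler`. Consumers: `X11b/JetchevChaPairs{1,…,5}.lean` (`a_ℓ = ℓ + 1 − n`; `E[5]`
irreducible by Mazur 1978 Prop. 6.3 (1) via `IntModel.hasIrreducibleModPGaloisRep_of_intModel_of_noroot`).
Witnesses found by the gen-3 script `code/b2b-bsdres-x11c/gen3/lean_gen/compute_pairs.py` (naive count);
the kernel RE-VERIFIES every count. Labels in this part: `3240d1`, `5780c1`, `21660u1`, `23120ba1`, `25920cm1`, `51840bo1`, `52020bk1`, `59040bf1`, `59040bg1`, `64980bu1`, `64980e1`, `74420e1`, `74420f1`, `84960z1`, `92480ch1`, `152280g1`, `154880d1`, `154880g1`, `158760cs1`.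

References: B. Mazur, Invent. Math. 44 (1978) Prop. 6.3 (1) [Mazur1978]; K. Ireland, M. Rosen, GTM 84
(1990) §8.1 [IrelandRosen1990]; J. E. Cremona, *Algorithms for Modular Elliptic Curves* (1997),
Table 1 [CremonaAlgorithms1997].
-/

set_option linter.dupNamespace false

namespace Summit.BirchSwinnertonDyer.Rank1Residual.X11b

open Literature.NumberTheory.EllipticCurves

/-- `#Ẽ(𝔽_7) = 8` (`a_7 = 0`; `X² − a_7X + 7` root-free mod `p = 5`) for Cremona's model `3240d1`. [folklore] -/
theorem card_j3240d1_7 :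
    Nat.card (((⟨0, 0, 0, -8532, 303156⟩ : WeierstrassCurve ℤ).map (Int.castRingHom (ZMod 7))).toAffine.Point) = 8 := by
  rw [@WeierstrassCurve.natCard_point_eq_one_add_card (ZMod 7) (@ZMod.instField 7 ⟨by norm_num⟩) _ _ _
    (by decide +kernel), @card_sol_eq_sum_euler (ZMod 7) (@ZMod.instField 7 ⟨by norm_num⟩) _ _
    (by rw [ZMod.ringChar_zmod_n]; decide), ZMod.card]
  decide +kernel

/-- `#Ẽ(𝔽_3) = 4` (`a_3 = 0`; `X² − a_3X + 3` root-free mod `p = 5`) for Cremona's model `5780c1`. [folklore] -/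
theorem card_j5780c1_3 :
    Nat.card (((⟨0, 0, 0, -272, -1564⟩ : WeierstrassCurve ℤ).map (Int.castRingHom (ZMod 3))).toAffine.Point) = 4 := by
  rw [@WeierstrassCurve.natCard_point_eq_one_add_card (ZMod 3) (@ZMod.instField 3 ⟨by norm_num⟩) _ _ _
    (by decide +kernel), @card_sol_eq_sum_euler (ZMod 3) (@ZMod.instField 3 ⟨by norm_num⟩) _ _
    (by rw [ZMod.ringChar_zmod_n]; decide), ZMod.card]
  decide +kernel

/-- `#Ẽ(𝔽_7) = 13` (`a_7 = -5`; `X² − a_7X + 7` root-free mod `p = 5`) for Cremona's model `21660u1`. [folklore] -/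
theorem card_j21660u1_7 :
    Nat.card (((⟨0, 1, 0, 1472399, -1009356976⟩ : WeierstrassCurve ℤ).map (Int.castRingHom (ZMod 7))).toAffine.Point) = 13 := by
  rw [@WeierstrassCurve.natCard_point_eq_one_add_card (ZMod 7) (@ZMod.instField 7 ⟨by norm_num⟩) _ _ _
    (by decide +kernel), @card_sol_eq_sum_euler (ZMod 7) (@ZMod.instField 7 ⟨by norm_num⟩) _ _
    (by rw [ZMod.ringChar_zmod_n]; decide), ZMod.card]
  decide +kernel

/-- `#Ẽ(𝔽_3) = 4` (`a_3 = 0`; `X² − a_3X + 3` root-free mod `p = 5`) for Cremona's model `23120ba1`. [folklore] -/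
theorem card_j23120ba1_3 :
    Nat.card (((⟨0, 0, 0, -272, 1564⟩ : WeierstrassCurve ℤ).map (Int.castRingHom (ZMod 3))).toAffine.Point) = 4 := by
  rw [@WeierstrassCurve.natCard_point_eq_one_add_card (ZMod 3) (@ZMod.instField 3 ⟨by norm_num⟩) _ _ _
    (by decide +kernel), @card_sol_eq_sum_euler (ZMod 3) (@ZMod.instField 3 ⟨by norm_num⟩) _ _
    (by rw [ZMod.ringChar_zmod_n]; decide), ZMod.card]
  decide +kernel

/-- `#Ẽ(𝔽_7) = 8` (`a_7 = 0`; `X² − a_7X + 7` root-free mod `p = 5`) for Cremona's model `25920cm1`. [folklore] -/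
theorem card_j25920cm1_7 :
    Nat.card (((⟨0, 0, 0, -3792, 89824⟩ : WeierstrassCurve ℤ).map (Int.castRingHom (ZMod 7))).toAffine.Point) = 8 := by
  rw [@WeierstrassCurve.natCard_point_eq_one_add_card (ZMod 7) (@ZMod.instField 7 ⟨by norm_num⟩) _ _ _
    (by decide +kernel), @card_sol_eq_sum_euler (ZMod 7) (@ZMod.instField 7 ⟨by norm_num⟩) _ _
    (by rw [ZMod.ringChar_zmod_n]; decide), ZMod.card]
  decide +kernel

/-- `#Ẽ(𝔽_11) = 8` (`a_11 = 4`; `X² − a_11X + 11` root-free mod `p = 5`) for Cremona's model `51840bo1`. [folklore] -/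
theorem card_j51840bo1_11 :
    Nat.card (((⟨0, 0, 0, -1377, 29646⟩ : WeierstrassCurve ℤ).map (Int.castRingHom (ZMod 11))).toAffine.Point) = 8 := by
  rw [@WeierstrassCurve.natCard_point_eq_one_add_card (ZMod 11) (@ZMod.instField 11 ⟨by norm_num⟩) _ _ _
    (by decide +kernel), @card_sol_eq_sum_euler (ZMod 11) (@ZMod.instField 11 ⟨by norm_num⟩) _ _
    (by rw [ZMod.ringChar_zmod_n]; decide), ZMod.card]
  decide +kernel

/-- `#Ẽ(𝔽_11) = 11` (`a_11 = 1`; `X² − a_11X + 11` root-free mod `p = 5`) for Cremona's model `52020bk1`. [folklore] -/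
theorem card_j52020bk1_11 :
    Nat.card (((⟨0, 0, 0, -707472, 207466164⟩ : WeierstrassCurve ℤ).map (Int.castRingHom (ZMod 11))).toAffine.Point) = 11 := by
  rw [@WeierstrassCurve.natCard_point_eq_one_add_card (ZMod 11) (@ZMod.instField 11 ⟨by norm_num⟩) _ _ _
    (by decide +kernel), @card_sol_eq_sum_euler (ZMod 11) (@ZMod.instField 11 ⟨by norm_num⟩) _ _
    (by rw [ZMod.ringChar_zmod_n]; decide), ZMod.card]
  decide +kernel

/-- `#Ẽ(𝔽_7) = 3` (`a_7 = 5`; `X² − a_7X + 7` root-free mod `p = 5`) for Cremona's model `59040bf1`. [folklore] -/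
theorem card_j59040bf1_7 :
    Nat.card (((⟨0, 0, 0, -1709883, -865485918⟩ : WeierstrassCurve ℤ).map (Int.castRingHom (ZMod 7))).toAffine.Point) = 3 := by
  rw [@WeierstrassCurve.natCard_point_eq_one_add_card (ZMod 7) (@ZMod.instField 7 ⟨by norm_num⟩) _ _ _
    (by decide +kernel), @card_sol_eq_sum_euler (ZMod 7) (@ZMod.instField 7 ⟨by norm_num⟩) _ _
    (by rw [ZMod.ringChar_zmod_n]; decide), ZMod.card]
  decide +kernel

/-- `#Ẽ(𝔽_7) = 13` (`a_7 = -5`; `X² − a_7X + 7` root-free mod `p = 5`) for Cremona's model `59040bg1`. [folklore] -/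
theorem card_j59040bg1_7 :
    Nat.card (((⟨0, 0, 0, -1709883, 865485918⟩ : WeierstrassCurve ℤ).map (Int.castRingHom (ZMod 7))).toAffine.Point) = 13 := by
  rw [@WeierstrassCurve.natCard_point_eq_one_add_card (ZMod 7) (@ZMod.instField 7 ⟨by norm_num⟩) _ _ _
    (by decide +kernel), @card_sol_eq_sum_euler (ZMod 7) (@ZMod.instField 7 ⟨by norm_num⟩) _ _
    (by rw [ZMod.ringChar_zmod_n]; decide), ZMod.card]
  decide +kernel

/-- `#Ẽ(𝔽_7) = 13` (`a_7 = -5`; `X² − a_7X + 7` root-free mod `p = 5`) for Cremona's model `64980bu1`. [folklore] -/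
theorem card_j64980bu1_7 :
    Nat.card (((⟨0, 0, 0, 36708, -3975199⟩ : WeierstrassCurve ℤ).map (Int.castRingHom (ZMod 7))).toAffine.Point) = 13 := by
  rw [@WeierstrassCurve.natCard_point_eq_one_add_card (ZMod 7) (@ZMod.instField 7 ⟨by norm_num⟩) _ _ _
    (by decide +kernel), @card_sol_eq_sum_euler (ZMod 7) (@ZMod.instField 7 ⟨by norm_num⟩) _ _
    (by rw [ZMod.ringChar_zmod_n]; decide), ZMod.card]
  decide +kernel

/-- `#Ẽ(𝔽_11) = 6` (`a_11 = 6`; `X² − a_11X + 11` root-free mod `p = 5`) for Cremona's model `64980e1`. [folklore] -/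
theorem card_j64980e1_11 :
    Nat.card (((⟨0, 0, 0, 1083, 14801⟩ : WeierstrassCurve ℤ).map (Int.castRingHom (ZMod 11))).toAffine.Point) = 6 := by
  rw [@WeierstrassCurve.natCard_point_eq_one_add_card (ZMod 11) (@ZMod.instField 11 ⟨by norm_num⟩) _ _ _
    (by decide +kernel), @card_sol_eq_sum_euler (ZMod 11) (@ZMod.instField 11 ⟨by norm_num⟩) _ _
    (by rw [ZMod.ringChar_zmod_n]; decide), ZMod.card]
  decide +kernel

/-- `#Ẽ(𝔽_7) = 8` (`a_7 = 0`; `X² − a_7X + 7` root-free mod `p = 5`) for Cremona's model `74420e1`. [folklore] -/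
theorem card_j74420e1_7 :
    Nat.card (((⟨0, -1, 0, -75660, 595909192⟩ : WeierstrassCurve ℤ).map (Int.castRingHom (ZMod 7))).toAffine.Point) = 8 := by
  rw [@WeierstrassCurve.natCard_point_eq_one_add_card (ZMod 7) (@ZMod.instField 7 ⟨by norm_num⟩) _ _ _
    (by decide +kernel), @card_sol_eq_sum_euler (ZMod 7) (@ZMod.instField 7 ⟨by norm_num⟩) _ _
    (by rw [ZMod.ringChar_zmod_n]; decide), ZMod.card]
  decide +kernel

/-- `#Ẽ(𝔽_7) = 8` (`a_7 = 0`; `X² − a_7X + 7` root-free mod `p = 5`) for Cremona's model `74420f1`. [folklore] -/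
theorem card_j74420f1_7 :
    Nat.card (((⟨0, -1, 0, -20, 2632⟩ : WeierstrassCurve ℤ).map (Int.castRingHom (ZMod 7))).toAffine.Point) = 8 := by
  rw [@WeierstrassCurve.natCard_point_eq_one_add_card (ZMod 7) (@ZMod.instField 7 ⟨by norm_num⟩) _ _ _
    (by decide +kernel), @card_sol_eq_sum_euler (ZMod 7) (@ZMod.instField 7 ⟨by norm_num⟩) _ _
    (by rw [ZMod.ringChar_zmod_n]; decide), ZMod.card]
  decide +kernel

/-- `#Ẽ(𝔽_7) = 8` (`a_7 = 0`; `X² − a_7X + 7` root-free mod `p = 5`) for Cremona's model `84960z1`. [folklore] -/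
theorem card_j84960z1_7 :
    Nat.card (((⟨0, 0, 0, -198168, -24103408⟩ : WeierstrassCurve ℤ).map (Int.castRingHom (ZMod 7))).toAffine.Point) = 8 := by
  rw [@WeierstrassCurve.natCard_point_eq_one_add_card (ZMod 7) (@ZMod.instField 7 ⟨by norm_num⟩) _ _ _
    (by decide +kernel), @card_sol_eq_sum_euler (ZMod 7) (@ZMod.instField 7 ⟨by norm_num⟩) _ _
    (by rw [ZMod.ringChar_zmod_n]; decide), ZMod.card]
  decide +kernel

/-- `#Ẽ(𝔽_3) = 4` (`a_3 = 0`; `X² − a_3X + 3` root-free mod `p = 5`) for Cremona's model `92480ch1`. [folklore] -/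
theorem card_j92480ch1_3 :
    Nat.card (((⟨0, 0, 0, -314432, -61471456⟩ : WeierstrassCurve ℤ).map (Int.castRingHom (ZMod 3))).toAffine.Point) = 4 := by
  rw [@WeierstrassCurve.natCard_point_eq_one_add_card (ZMod 3) (@ZMod.instField 3 ⟨by norm_num⟩) _ _ _
    (by decide +kernel), @card_sol_eq_sum_euler (ZMod 3) (@ZMod.instField 3 ⟨by norm_num⟩) _ _
    (by rw [ZMod.ringChar_zmod_n]; decide), ZMod.card]
  decide +kernel

/-- `#Ẽ(𝔽_7) = 8` (`a_7 = 0`; `X² − a_7X + 7` root-free mod `p = 5`) for Cremona's model `152280g1`. [folklore] -/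
theorem card_j152280g1_7 :
    Nat.card (((⟨0, 0, 0, -12087, -17603334⟩ : WeierstrassCurve ℤ).map (Int.castRingHom (ZMod 7))).toAffine.Point) = 8 := by
  rw [@WeierstrassCurve.natCard_point_eq_one_add_card (ZMod 7) (@ZMod.instField 7 ⟨by norm_num⟩) _ _ _
    (by decide +kernel), @card_sol_eq_sum_euler (ZMod 7) (@ZMod.instField 7 ⟨by norm_num⟩) _ _
    (by rw [ZMod.ringChar_zmod_n]; decide), ZMod.card]
  decide +kernel

/-- `#Ẽ(𝔽_7) = 13` (`a_7 = -5`; `X² − a_7X + 7` root-free mod `p = 5`) for Cremona's model `154880d1`. [folklore] -/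
theorem card_j154880d1_7 :
    Nat.card (((⟨0, -1, 0, -38317715, -91282339025⟩ : WeierstrassCurve ℤ).map (Int.castRingHom (ZMod 7))).toAffine.Point) = 13 := by
  rw [@WeierstrassCurve.natCard_point_eq_one_add_card (ZMod 7) (@ZMod.instField 7 ⟨by norm_num⟩) _ _ _
    (by decide +kernel), @card_sol_eq_sum_euler (ZMod 7) (@ZMod.instField 7 ⟨by norm_num⟩) _ _
    (by rw [ZMod.ringChar_zmod_n]; decide), ZMod.card]
  decide +kernel

/-- `#Ẽ(𝔽_7) = 3` (`a_7 = 5`; `X² − a_7X + 7` root-free mod `p = 5`) for Cremona's model `154880g1`. [folklore] -/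
theorem card_j154880g1_7 :
    Nat.card (((⟨0, -1, 0, -316675, 68696927⟩ : WeierstrassCurve ℤ).map (Int.castRingHom (ZMod 7))).toAffine.Point) = 3 := by
  rw [@WeierstrassCurve.natCard_point_eq_one_add_card (ZMod 7) (@ZMod.instField 7 ⟨by norm_num⟩) _ _ _
    (by decide +kernel), @card_sol_eq_sum_euler (ZMod 7) (@ZMod.instField 7 ⟨by norm_num⟩) _ _
    (by rw [ZMod.ringChar_zmod_n]; decide), ZMod.card]
  decide +kernel

/-- `#Ẽ(𝔽_11) = 11` (`a_11 = 1`; `X² − a_11X + 11` root-free mod `p = 5`) for Cremona's model `158760cs1`. [folklore] -/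
theorem card_j158760cs1_11 :
    Nat.card (((⟨0, 0, 0, -46452, 3851204⟩ : WeierstrassCurve ℤ).map (Int.castRingHom (ZMod 11))).toAffine.Point) = 11 := by
  rw [@WeierstrassCurve.natCard_point_eq_one_add_card (ZMod 11) (@ZMod.instField 11 ⟨by norm_num⟩) _ _ _
    (by decide +kernel), @card_sol_eq_sum_euler (ZMod 11) (@ZMod.instField 11 ⟨by norm_num⟩) _ _
    (by rw [ZMod.ringChar_zmod_n]; decide), ZMod.card]
  decide +kernel

end Summit.BirchSwinnertonDyer.Rank1Residual.X11b
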